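import Summits.CriticalPhenomena.PercolationContinuityZ3.Theorems.PercNearOneGluingNoHeavyLowerTailCILOvertakingCellBounds
import Summits.CriticalPhenomena.PercolationContinuityZ3.Theorems.PercNearOneGluingNoHeavyLowerTailCILSeparatedStarExpansion
import Summits.CriticalPhenomena.PercolationContinuityZ3.Theorems.PercNearOneGluingNoHeavyLowerTailCILDoubleStarExpansion
import HarnessLib

/-!
# `NoHeavyLowerTail` (stmt-CriticalPhenomena-4575) — THE OVERTAKING BOUND for the two-sided kernel of the hull-port step:
# `F ≥ (I_w(i) − I_w(x)) − Ω_x`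

Support file (prover `prim-hp-3`, hull-port line; `--supports stmt-CriticalPhenomena-4575`).  No definitions, no named facts, no sorries.
Final step (Step 4) of run/shared/lean/prim/prim-hp-3/PROOF-OVERTAKING-BOUND.md; crux notes HULLPORT-REF-gen2.md §9 (THM'').

Setting: `μ_w = prodBernoulli w` on `Fin n`, relays `A`, level `j`; two non-relay observers `s₁ ≠ s₂` whose positive pairs end in the port sets
`P₁, P₂ ⊆ A`; a relay `i ∉ P₂` (the witness) and any relay `x` (the reference).  `F := μ_w(i ↮ {s₁,s₂}, |π(i)| ≤ j) − μ_w(i ↮ {s₁,s₂},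
1 ≤ |π(s₁) ∪ π(s₂)| ≤ j)` is the separated margin of the glued observer pair (`F ≥ 0` is `CS_w({s₁,s₂}, i)`, the two-sided kernel, cf.
`Hyperedge.setCS_pair_of_hyperedgeDD`, `…CILTwoPendantStars`).  Conditioning on both stars (cells `(T,S)`, `T ⊆ P₁`, `S ⊆ P₂`, inner weight
`K = (w∖s₂)∖s₁`) the OVERTAKING MASS is
  `Ω_x := Σ_S μ_w(σ²_S) Σ_T μ_{w∖s₂}(σ¹_T) · max 0 (max ℓ_T ℓ_S − c₂(x))`,
`ℓ_B` = `μ_K`(the glued block `B` meets between 1 and `j` relays), `c₂(x)` = two-block lightness of `x` — how much a glued sub-block of the stars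
overtakes `x` in that cell.  **Theorem (`Hyperedge.overtaking_bound`): `I_w(i) − I_w(x) − Ω_x ≤ F`.**  Hence the two-sided kernel holds whenever
`I_w(i) − I_w(x) ≥ Ω_x` for some relay `x` (99.7 % of random instances in the seat's census; `Ω_x = 0` = "robust domination").

Proof = the seat's roadmap: Step 1 `Hyperedge.pairCSdiff_double_star_expansion`, Step 2 `Hyperedge.lightness_double_star_expansion`, and per cell
(`cell_bound_disjoint` via `Hyperedge.overtaking_cell` = glue bridges + `HullPort.lightness_margin_glue_ge_max_any`, i.e. ABSORPTION MONOTONICITY;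
`cell_bound_empty_left/right`, `cell_bound_meet` for the degenerate cells, where the two closures coincide), then summation with nonnegative weights.
Auxiliary: `twoBlock_orient_iff` (the two expansions write the closure with `Reach c v` vs `Reach v c`), root lemmas `reachClosure_rootS_iff`,
`reachClosure_rootOne_iff`.
-/

noncomputable section

namespace Summit.CriticalPhenomena.PercolationContinuityZ3.Theorems

open MeasureTheory Set Literature.Probability.LatticeModels Literature.Probability.Percolation
open scoped Classical BigOperators

variable {n : ℕ}

namespace Hyperedge

/-- **THE OVERTAKING BOUND** (crux notes HULLPORT-REF-gen2.md §9, THM'').  Two non-relay observers `s₁ ≠ s₂` with ports in `P₁, P₂ ⊆ A`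
(positive pairs of `s_k` end in `P_k`), a relay `i ∉ P₂` and any relay `x`.  With `F = μ_w(i ↮ {s₁,s₂}, |π(i)| ≤ j) − μ_w(i ↮ {s₁,s₂},
1 ≤ |π(s₁) ∪ π(s₂)| ≤ j)` (the two-observer separated margin, `= CSdiff_w({s₁,s₂}, i)`), `D_x = I_w(i) − I_w(x)`, and the OVERTAKING MASS
`Ω_x = Σ_S μ_w(σ²_S) Σ_T μ_{w∖s₂}(σ¹_T) · max 0 (max ℓ_T ℓ_S − c₂(x))` (cells of the double star expansion; `ℓ_B` = probability that the glued
block `B` meets between 1 and `j` relays, `c₂(x)` = two-block lightness of `x`, all under `K = (w∖s₂)∖s₁`):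
      `F ≥ D_x − Ω_x`.
In particular `F ≥ 0` (i.e. `CS_w({s₁,s₂}, i)`, the two-sided kernel of the hull-port step) as soon as `D_x ≥ Ω_x` for SOME relay `x` — e.g. when `i`
dominates `x` in `w` and no glued sub-block of the two stars ever overtakes `x` ("robust domination", `Ω_x = 0`).  Proof: Steps 1–3 of the seat's
roadmap (double star expansions, glue bridges, `HullPort.lightness_margin_glue_ge_max_any` cellwise) and the four cell lemmas of this file. [this file] -/
theorem overtaking_bound (w : Sym2 (Fin n) → unitInterval) (A : Finset (Fin n)) (s₁ s₂ i x : Fin n)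
    (P₁ P₂ : Finset (Fin n)) (j : ℕ) (h1A : s₁ ∉ A) (h2A : s₂ ∉ A) (hiA : i ∈ A) (hxA : x ∈ A) (h12 : s₁ ≠ s₂)
    (h1P1 : s₁ ∉ P₁) (h2P2 : s₂ ∉ P₂) (hiP2 : i ∉ P₂) (hP1A : P₁ ⊆ A) (hP2A : P₂ ⊆ A)
    (hobs₁ : ∀ y, y ≠ s₁ → y ∉ P₁ → w s(s₁, y) = 0) (hobs₂ : ∀ y, y ≠ s₂ → y ∉ P₂ → w s(s₂, y) = 0) :
    (prodBernoulli w).real {ω : BondConfig (Fin n) | (A.filter fun z => ω ∈ openConn i z).card ≤ j} -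
        (prodBernoulli w).real {ω : BondConfig (Fin n) | (A.filter fun z => ω ∈ openConn x z).card ≤ j} -
        ∑ S ∈ P₂.powerset, (prodBernoulli w).real (starEvent s₂ (↑S : Set (Fin n))) *
          ∑ T ∈ P₁.powerset,
            (prodBernoulli (fun e => if s₂ ∈ e then (0 : unitInterval) else w e)).real (starEvent s₁ (↑T : Set (Fin n))) *
            max 0 (max ((prodBernoulli (fun e => if s₁ ∈ e then (0 : unitInterval) else if s₂ ∈ e then (0 : unitInterval) else w e)).real {ω : BondConfig (Fin n) | 1 ≤ (A.filter fun z => ∃ u ∈ T, (((openGraph ω).Reachable u z ∨ ((∃ t ∈ T, (openGraph ω).Reachable u t) ∧ ∃ t ∈ T, (openGraph ω).Reachable t z)) ∨ ((∃ s ∈ S, (openGraph ω).Reachable u s ∨ ((∃ t ∈ T, (openGraph ω).Reachable u t) ∧ ∃ t ∈ T, (openGraph ω).Reachable t s)) ∧ ∃ s ∈ S, (openGraph ω).Reachable s z ∨ ((∃ t ∈ T, (openGraph ω).Reachable s t) ∧ ∃ t ∈ T, (openGraph ω).Reachable t z)))).card ∧ (A.filter fun z => ∃ u ∈ T, (((openGraph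 ω).Reachable u z ∨ ((∃ t ∈ T, (openGraph ω).Reachable u t) ∧ ∃ t ∈ T, (openGraph ω).Reachable t z)) ∨ ((∃ s ∈ S, (openGraph ω).Reachable u s ∨ ((∃ t ∈ T, (openGraph ω).Reachable u t) ∧ ∃ t ∈ T, (openGraph ω).Reachable t s)) ∧ ∃ s ∈ S, (openGraph ω).Reachable s z ∨ ((∃ t ∈ T, (openGraph ω).Reachable s t) ∧ ∃ t ∈ T, (openGraph ω).Reachable t z)))).card ≤ j})
              ((prodBernoulli (fun e => if s₁ ∈ e then (0 : unitInterval) else if s₂ ∈ e then (0 : unitInterval) else w e)).real {ω : BondConfig (Fin n) | 1 ≤ (A.filter fun z => ∃ u ∈ S, (((openGraph ω).Reachable u z ∨ ((∃ t ∈ T, (openGraph ω).Reachable u t) ∧ ∃ t ∈ T, (openGraph ω).Reachable t z)) ∨ ((∃ s ∈ S, (openGraph ω).Reachable u s ∨ ((∃ t ∈ T, (openGraph ω).Reachable u t) ∧ ∃ t ∈ T, (openGraph ω).Reachable t s)) ∧ ∃ s ∈ S, (openGraph ω).Reachable s z ∨ ((∃ t ∈ T, (openGraph ω).Reachable s t)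 ∧ ∃ t ∈ T, (openGraph ω).Reachable t z)))).card ∧ (A.filter fun z => ∃ u ∈ S, (((openGraph ω).Reachable u z ∨ ((∃ t ∈ T, (openGraph ω).Reachable u t) ∧ ∃ t ∈ T, (openGraph ω).Reachable t z)) ∨ ((∃ s ∈ S, (openGraph ω).Reachable u s ∨ ((∃ t ∈ T, (openGraph ω).Reachable u t) ∧ ∃ t ∈ T, (openGraph ω).Reachable t s)) ∧ ∃ s ∈ S, (openGraph ω).Reachable s z ∨ ((∃ t ∈ T, (openGraph ω).Reachable s t) ∧ ∃ t ∈ T, (openGraph ω).Reachable t z)))).card ≤ j}) -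
              (prodBernoulli (fun e => if s₁ ∈ e then (0 : unitInterval) else if s₂ ∈ e then (0 : unitInterval) else w e)).real {ω : BondConfig (Fin n) | (A.filter fun z => (((openGraph ω).Reachable x z ∨ ((∃ c ∈ T, (openGraph ω).Reachable c x) ∧ ∃ c' ∈ T, (openGraph ω).Reachable c' z)) ∨ ((∃ s ∈ S, (openGraph ω).Reachable s x ∨ ((∃ c ∈ T, (openGraph ω).Reachable c s) ∧ ∃ c' ∈ T, (openGraph ω).Reachable c' x)) ∧ ∃ s' ∈ S, (openGraph ω).Reachable s' z ∨ ((∃ c ∈ T, (openGraph ω).Reachable c s') ∧ ∃ c' ∈ T, (openGraph ω).Reachable c' z)))).card ≤ j}) ≤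
      (prodBernoulli w).real {ω : BondConfig (Fin n) | (∀ x ∈ ({s₁, s₂} : Finset (Fin n)), ω ∉ openConn i x) ∧
        (A.filter fun z => ω ∈ openConn i z).card ≤ j} -
      (prodBernoulli w).real {ω : BondConfig (Fin n) | (∀ x ∈ ({s₁, s₂} : Finset (Fin n)), ω ∉ openConn i x) ∧
        1 ≤ (A.filter fun z => ∃ x ∈ ({s₁, s₂} : Finset (Fin n)), ω ∈ openConn x z).card ∧
        (A.filter fun z => ∃ x ∈ ({s₁, s₂} : Finset (Fin n)), ω ∈ openConn x z).card ≤ j} := by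
  have hi1 : i ≠ s₁ := fun h => h1A (h ▸ hiA)
  have hi2 : i ≠ s₂ := fun h => h2A (h ▸ hiA)
  have h1P2 : s₁ ∉ P₂ := fun h => h1A (hP2A h)
  rw [pairCSdiff_double_star_expansion w A s₁ s₂ i P₁ P₂ j h1A h2A h12 hi1 hi2 h1P1 h2P2 h1P2 hiP2 hobs₁ hobs₂,
    lightness_double_star_expansion w A s₁ s₂ i P₁ P₂ j h1A h2A hiA h1P1 h2P2 hP2A hobs₁ hobs₂,
    lightness_double_star_expansion w A s₁ s₂ x P₁ P₂ j h1A h2A hxA h1P1 h2P2 hP2A hobs₁ hobs₂,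
    ← Finset.sum_sub_distrib, ← Finset.sum_sub_distrib]
  refine Finset.sum_le_sum fun S hS => ?_
  have hSA : S ⊆ A := (Finset.mem_powerset.1 hS).trans hP2A
  rw [← mul_sub, ← mul_sub]
  refine mul_le_mul_of_nonneg_left ?_ measureReal_nonneg
  rw [← Finset.sum_sub_distrib, ← Finset.sum_sub_distrib]
  refine Finset.sum_le_sum fun T hT => ?_
  have hTA : T ⊆ A := (Finset.mem_powerset.1 hT).trans hP1A
  rw [← mul_sub, ← mul_sub]
  refine mul_le_mul_of_nonneg_left ?_ measureReal_nonneg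
  -- the cell bound, by cases on the blocks
  rcases T.eq_empty_or_nonempty with rfl | hTne
  · exact cell_bound_empty_left _ A S hSA i x j
  rcases S.eq_empty_or_nonempty with rfl | hSne
  · exact cell_bound_empty_right _ A T hTA i x j
  by_cases hmeet : (T ∩ S).Nonempty
  · obtain ⟨v, hv⟩ := hmeet
    rw [Finset.mem_inter] at hv
    exact cell_bound_meet _ A T S hTA hSA hv.1 hv.2 i x j
  · exact cell_bound_disjoint _ A T S i x j hTA hSA hTne hSne
      (Finset.disjoint_iff_inter_eq_empty.2 (Finset.not_nonempty_iff_eq_empty.1 hmeet))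

end Hyperedge

end Summit.CriticalPhenomena.PercolationContinuityZ3.Theorems
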